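import Summits.FinalStateConjecture.FinalStateConjecture.Theorems.EIHFluxBalanceLLSphericalVolume
import Mathlib.MeasureTheory.Group.Measure

/-!
# Route EIHFluxBalance — `LLBalanceLaw` (v): the spherical shell formula

Helper file for the support item `stmt-FinalStateConjecture-10189`
(`Summit.FinalStateConjecture.FinalStateConjecture.Theses.EIHFluxBalance.LLBalanceLaw`). Clause (v)
of that item, literally (`LLSphere.llBalanceLaw_shell`): for a continuous `f : E3 → ℝ`, a centre
`ξ` and `R > 0`,

  `∫_{ρ ∈ (R, 2R)} (∮_{|y − ξ| = ρ} f dμHE[2]) dρ = ∫_{R < |y − ξ| < 2R} f(y) dy`,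

obtained from the centred shell formula of `EIHFluxBalanceLLSphericalVolume`
(`setIntegral_shell_eq_integral_setIntegral_sphere`: spherical coordinates, Fubini, and the area
formula for the Euclidean Hausdorff measure `μHE[2]` on round spheres) by translating by `ξ`, both
Lebesgue measure and `μHE[2]` being translation invariant (`measurePreserving_add_left`), and from
the integrability of a continuous function on the bounded shell. The radius-averaging lemma of
Landau–Lifshitz-type flux arguments (turning sphere fluxes into shell integrals; cf.
arXiv:1310.1528, §2). [cite: Federer1969, 3.2.5]
-/

noncomputable section

open MeasureTheory MeasureTheory.Measure Set Function Filter Metric Module Real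
open scoped Topology ENNReal

namespace Summit.FinalStateConjecture.FinalStateConjecture.Theorems

namespace LLSphere

open Literature.Geometry.Lorentzian

/-! ### Translation to a general centre -/

/-- Translating a set integral for a translation-invariant measure on `E3`:
`∫_{S} f dμ = ∫_{(ξ + ·)⁻¹ S} f(ξ + z) dμ(z)`. [folklore] -/
theorem setIntegral_eq_setIntegral_preimage_add_left (μ : Measure E3) [μ.IsAddLeftInvariant]
    (ξ : E3) (f : E3 → ℝ) (S : Set E3) :
    ∫ y in S, f y ∂μ = ∫ z in (fun z ↦ ξ + z) ⁻¹' S, f (ξ + z) ∂μ :=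
  ((measurePreserving_add_left μ ξ).setIntegral_preimage_emb
    (MeasurableEquiv.addLeft ξ).measurableEmbedding f S).symm

/-- The translate of a sphere about `ξ` is the sphere about `0`. [folklore] -/
theorem preimage_add_left_sphere (ξ : E3) (ρ : ℝ) :
    (fun z : E3 ↦ ξ + z) ⁻¹' sphere ξ ρ = sphere (0 : E3) ρ := by
  ext z
  simp

/-- The translate of a shell about `ξ` is the shell about `0`. [folklore] -/
theorem preimage_add_left_shell (ξ : E3) (R : ℝ) :
    (fun z : E3 ↦ ξ + z) ⁻¹' {y : E3 | R < dist y ξ ∧ dist y ξ < 2 * R} =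
      {z : E3 | R < ‖z‖ ∧ ‖z‖ < 2 * R} := by
  ext z
  simp [dist_eq_norm]

/-- A continuous function is integrable on the bounded shell `{R < |z| < 2R}`. [folklore] -/
theorem integrableOn_shell_of_continuous {f : E3 → ℝ} (hf : Continuous f) (R : ℝ) :
    IntegrableOn f {z : E3 | R < ‖z‖ ∧ ‖z‖ < 2 * R} :=
  (hf.continuousOn.integrableOn_compact (isCompact_closedBall (0 : E3) (2 * R))).mono_set
    fun _ hz ↦ mem_closedBall_zero_iff.mpr hz.2.le

/-! ### Clause (v) of `LLBalanceLaw` -/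

/-- **The spherical shell formula, clause (v) of `Theses.EIHFluxBalance.LLBalanceLaw`, literally**:
for a continuous `f : E3 → ℝ`, a centre `ξ ∈ E3` and `R > 0`,
`∫_{ρ ∈ (R, 2R)} (∮_{|y − ξ| = ρ} f dμHE[2]) dρ = ∫_{R < |y − ξ| < 2R} f`
(translation to `ξ = 0` and `setIntegral_shell_eq_integral_setIntegral_sphere`). The
radius-averaging device of pseudotensor flux arguments (sphere fluxes of quadratic quantities
become shell integrals bounded by energies). [cite: Federer1969, 3.2.5] -/
theorem llBalanceLaw_shell :
    ∀ (f : E3 → ℝ) (ξ : E3) (R : ℝ), 0 < R → Continuous f →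
      ∫ ρ in Set.Ioo R (2 * R), ∫ y in Metric.sphere ξ ρ, f y ∂(μHE[2] : Measure E3) =
        ∫ y in {y : E3 | R < dist y ξ ∧ dist y ξ < 2 * R}, f y := by
  intro f ξ R hR hf
  have hg : Continuous fun z : E3 ↦ f (ξ + z) := hf.comp (continuous_const.add continuous_id)
  -- translate both sides to the centre `0`
  have hsph : ∀ ρ : ℝ, ∫ y in sphere ξ ρ, f y ∂(μHE[2] : Measure E3) =
      ∫ z in sphere (0 : E3) ρ, f (ξ + z) ∂(μHE[2] : Measure E3) := fun ρ ↦ by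
    rw [setIntegral_eq_setIntegral_preimage_add_left (μHE[2] : Measure E3) ξ f,
      preimage_add_left_sphere]
  have hshell : ∫ y in {y : E3 | R < dist y ξ ∧ dist y ξ < 2 * R}, f y =
      ∫ z in {z : E3 | R < ‖z‖ ∧ ‖z‖ < 2 * R}, f (ξ + z) := by
    rw [setIntegral_eq_setIntegral_preimage_add_left volume ξ f, preimage_add_left_shell]
  simp_rw [hsph]
  rw [hshell]
  exact (setIntegral_shell_eq_integral_setIntegral_sphere hR
    (integrableOn_shell_of_continuous hg R)).symm

end LLSphere

end Summit.FinalStateConjecture.FinalStateConjecture.Theorems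

end
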